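import Summits.AtomisticToContinuum.HydrodynamicLimit.Theorems.InformationPercolationEnginePercolationClosesChaosPredictableProjectionStep
import HarnessLib

/-!
# The predictable-projection bound (stub `stub_predictableProjection`)

The LEVER of the line `equilibrium-forecast-chain-rule` of the crux
`InformationPercolationEngine.PercolationClosesChaos` (stmt-AtomisticToContinuum-15178): the statement
`PredictableProjection` of the line skeleton, unfolded. For probability laws `μ, ν` on `Ω` with
`KL(μ ‖ ν) < ∞`, observations `Y_k : Ω → S` into a countable alphabet generating the filtration
`𝓕_k = σ(Y_0, …, Y_k)` (discrete σ-algebra on the alphabet), and increments `X_k` that are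
`𝓕_{k+1}`-measurable and bounded by `C`, the `μ`- and `ν`-predictable compensators of `Σ_{k<K} X_k` differ in
`L¹(μ)` by at most `C √(2 K · KL(μ ‖ ν))`:

  `Σ_{k<K} ∫ |μ[X_k | 𝓕_k] - ν[X_k | 𝓕_k]| dμ ≤ C √(2 K KL(μ ‖ ν))`.

Proof (`sum_integral_abs_condExp_sub_condExp_le`, for an abstract nested sequence of countable observations
`π_k` with `π_{k+1} ≃ (π_k, Y_{k+1})`): with `D_k = Σ'_t ν(π_k = t) klFun(μ(π_k = t)/ν(π_k = t))` the
relative entropy of the laws of `π_k` (`klFun` currency), the one-step estimate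
`integral_abs_condExp_sub_condExp_le` gives `D_k ≤ D_{k+1}` and `∫ |μ[X_k|𝓕_k] - ν[X_k|𝓕_k]| dμ ≤
C √(2 (D_{k+1} - D_k))` (fibre averages, countable Pinsker with the sharp constant, chain rule,
Cauchy–Schwarz over atoms); Cauchy–Schwarz over `k`, telescoping and the partition data-processing
inequality `D_K ≤ KL(μ ‖ ν)` (`tsum_mul_klFun_fibre_le_toReal_klDiv`) conclude. The instance
`π_k = (Y_0, …, Y_k) : Ω → (Fin (k+1) → S)` with the recoding `Fin.snocEquiv` is `stub_predictableProjection`.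

## References
* Y. Polyanskiy, Y. Wu, *Information Theory: From Coding to Learning* (2024), Ch. 2 (chain rule, data
  processing), Thm. 7.10 (Pinsker).
* T. M. Cover, J. A. Thomas, *Elements of Information Theory*, 2nd ed. (2006), §2.5, Lemma 11.6.1.
-/

noncomputable section

namespace Summit.AtomisticToContinuum.HydrodynamicLimit.Theorems.EquilibriumForecastLine

open MeasureTheory Set InformationTheory Literature.Probability.Process
open scoped ENNReal

/-- **The predictable-projection bound along an abstract nested sequence of countable observations.**
`π_k : Ω → T_k` observations into countable sets with `σ(π_k) ≤` the ambient σ-algebra, recodings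
`e_k : T_k × S ≃ T_{k+1}` with `e_k (π_k, Y_{k+1}) = π_{k+1}`, increments `X_k` measurable for `σ(π_{k+1})`
with `|X_k| ≤ C`, and probability laws `μ ≪ ν` with `llr μ ν ∈ L¹(μ)`:
`Σ_{k<K} ∫ |μ[X_k | σ(π_k)] - ν[X_k | σ(π_k)]| dμ ≤ C √(2 K KL(μ ‖ ν))`. [folklore] -/
theorem sum_integral_abs_condExp_sub_condExp_le {Ω : Type*} {mΩ : MeasurableSpace Ω}
    (μ ν : Measure Ω) [IsProbabilityMeasure μ] [IsProbabilityMeasure ν] (hμν : μ ≪ ν)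
    (h_int : Integrable (llr μ ν) μ) {T : ℕ → Type*} [∀ k, Countable (T k)] (π : ∀ k, Ω → T k)
    {S : Type*} [Countable S] (Y : ℕ → Ω → S) (e : ∀ k, (T k × S) ≃ T (k + 1))
    (he : ∀ k ω, e k (π k ω, Y (k + 1) ω) = π (k + 1) ω)
    (hle : ∀ k, MeasurableSpace.comap (π k) ⊤ ≤ mΩ) (X : ℕ → Ω → ℝ) {C : ℝ}
    (hX : ∀ k, Measurable[MeasurableSpace.comap (π (k + 1)) ⊤] (X k)) (hC : ∀ k ω, |X k ω| ≤ C)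
    (K : ℕ) :
    ∑ k ∈ Finset.range K,
        ∫ ω, |μ[X k | MeasurableSpace.comap (π k) ⊤] ω - ν[X k | MeasurableSpace.comap (π k) ⊤] ω| ∂μ ≤
      C * Real.sqrt (2 * K * (klDiv μ ν).toReal) := by
  classical
  have hC0 : 0 ≤ C := (abs_nonneg _).trans (hC 0 (nonempty_of_isProbabilityMeasure μ).some)
  -- the divergences of the laws of `π k`
  set D : ℕ → ℝ := fun k =>
    ∑' t : T k, ν.real (π k ⁻¹' {t}) * klFun (μ.real (π k ⁻¹' {t}) / ν.real (π k ⁻¹' {t})) with hD_def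
  have hA : ∀ k t, MeasurableSet (π k ⁻¹' {t}) := fun k t =>
    hle k _ (measurableSet_comap_top_fibre (π k) t)
  have hsum : ∀ k, Summable fun t : T k =>
      ν.real (π k ⁻¹' {t}) * klFun (μ.real (π k ⁻¹' {t}) / ν.real (π k ⁻¹' {t})) := fun k =>
    summable_mul_klFun_fibre μ ν hμν h_int (π k) (hA k)
  have hDle : ∀ k, D k ≤ (klDiv μ ν).toReal := fun k =>
    tsum_mul_klFun_fibre_le_toReal_klDiv μ ν hμν h_int (π k) (hA k)
  have hD0 : ∀ k, 0 ≤ D k := fun k => tsum_nonneg fun t =>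
    mul_nonneg measureReal_nonneg (klFun_nonneg (div_nonneg measureReal_nonneg measureReal_nonneg))
  -- one step of the filtration
  have hstep : ∀ k, D k ≤ D (k + 1) ∧
      ∫ ω, |μ[X k | MeasurableSpace.comap (π k) ⊤] ω - ν[X k | MeasurableSpace.comap (π k) ⊤] ω| ∂μ ≤
        C * Real.sqrt (2 * (D (k + 1) - D k)) := by
    intro k
    have hρπ : ∀ a b, (π k a, Y (k + 1) a) = (π k b, Y (k + 1) b) ↔ π (k + 1) a = π (k + 1) b :=
      fun a b => by rw [← he k a, ← he k b, (e k).apply_eq_iff_eq]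
    have hρ_le : MeasurableSpace.comap (fun ω => (π k ω, Y (k + 1) ω)) ⊤ ≤ mΩ :=
      (comap_top_le_comap_top_of_forall_eq fun a b hab => (hρπ a b).2 hab).trans (hle (k + 1))
    have hXk : Measurable[MeasurableSpace.comap (fun ω => (π k ω, Y (k + 1) ω)) ⊤] (X k) :=
      (hX k).mono (comap_top_le_comap_top_of_forall_eq fun a b hab => (hρπ a b).1 hab) le_rfl
    have hfib : ∀ p, π (k + 1) ⁻¹' {e k p} = (fun ω => (π k ω, Y (k + 1) ω)) ⁻¹' {p} := fun p => by
      ext ω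
      simp only [mem_preimage, mem_singleton_iff]
      rw [← he k ω, (e k).apply_eq_iff_eq]
    have hD2 : HasSum (fun p : T k × S => ν.real ((fun ω => (π k ω, Y (k + 1) ω)) ⁻¹' {p}) *
        klFun (μ.real ((fun ω => (π k ω, Y (k + 1) ω)) ⁻¹' {p}) /
          ν.real ((fun ω => (π k ω, Y (k + 1) ω)) ⁻¹' {p}))) (D (k + 1)) := by
      have h := (hsum (k + 1)).hasSum
      rw [← (e k).hasSum_iff] at h
      simpa only [Function.comp_def, hfib] using h
    exact integral_abs_condExp_sub_condExp_le μ ν hμν (π k) (Y (k + 1)) hρ_le hXk (hC k)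
      (hsum k).hasSum hD2
  have hmono : ∀ k, 0 ≤ 2 * (D (k + 1) - D k) := fun k => mul_nonneg zero_le_two (sub_nonneg.2 (hstep k).1)
  -- Cauchy–Schwarz over `k`, telescoping, data processing
  calc ∑ k ∈ Finset.range K,
        ∫ ω, |μ[X k | MeasurableSpace.comap (π k) ⊤] ω - ν[X k | MeasurableSpace.comap (π k) ⊤] ω| ∂μ
      ≤ ∑ k ∈ Finset.range K, C * Real.sqrt (2 * (D (k + 1) - D k)) :=
        Finset.sum_le_sum fun k _ => (hstep k).2
    _ = C * ∑ k ∈ Finset.range K, Real.sqrt 1 * Real.sqrt (2 * (D (k + 1) - D k)) := by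
        rw [Finset.mul_sum]
        simp only [Real.sqrt_one, one_mul]
    _ ≤ C * (Real.sqrt (∑ k ∈ Finset.range K, (1 : ℝ)) *
          Real.sqrt (∑ k ∈ Finset.range K, 2 * (D (k + 1) - D k))) :=
        mul_le_mul_of_nonneg_left (Real.sum_sqrt_mul_sqrt_le (Finset.range K) (fun _ => zero_le_one) hmono) hC0
    _ = C * (Real.sqrt K * Real.sqrt (2 * (D K - D 0))) := by
        rw [Finset.sum_const, Finset.card_range, nsmul_eq_mul, mul_one, ← Finset.mul_sum,
          Finset.sum_range_sub]
    _ ≤ C * (Real.sqrt K * Real.sqrt (2 * (klDiv μ ν).toReal)) :=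
        mul_le_mul_of_nonneg_left (mul_le_mul_of_nonneg_left
          (Real.sqrt_le_sqrt (by linarith [hDle K, hD0 0])) (Real.sqrt_nonneg _)) hC0
    _ = C * Real.sqrt (2 * K * (klDiv μ ν).toReal) := by
        rw [← Real.sqrt_mul (Nat.cast_nonneg K),
          show (K : ℝ) * (2 * (klDiv μ ν).toReal) = 2 * K * (klDiv μ ν).toReal by ring]

/-- **Stub S1 `stub_predictableProjection` — the predictable-projection bound** (`PredictableProjection` of the
line skeleton `equilibrium-forecast-chain-rule`, unfolded, same binders). For probability laws `μ, ν` on `Ω` with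
`KL(μ ‖ ν) < ∞`, observations `Y_k : Ω → S` into a countable alphabet generating
`𝓕_k = σ(Y_0, …, Y_k)`, and increments `X_k` that are `𝓕_{k+1}`-measurable with `|X_k| ≤ C`:
`Σ_{k<K} E_μ |E_μ[X_k | 𝓕_k] − E_ν[X_k | 𝓕_k]| ≤ C √(2 K KL(μ ‖ ν))`. Pinsker on a countable alphabet with
the sharp constant, the chain rule and data processing in `klFun` currency, Cauchy–Schwarz
(Cover–Thomas 2006, Lemma 11.6.1 and Thm. 2.5.3; Polyanskiy–Wu 2024, Ch. 2). -/
theorem stub_predictableProjection {Ω : Type} [MeasurableSpace Ω] {S : Type} [Countable S]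
    (μ ν : Measure Ω) [IsProbabilityMeasure μ] [IsProbabilityMeasure ν] (Y : ℕ → Ω → S)
    (X : ℕ → Ω → ℝ) (C : ℝ) (K : ℕ)
    (hle : ∀ k, MeasurableSpace.comap (fun ω => fun j : Fin (k + 1) => Y j ω) ⊤ ≤ ‹MeasurableSpace Ω›)
    (hX : ∀ k, Measurable[MeasurableSpace.comap (fun ω => fun j : Fin (k + 1 + 1) => Y j ω) ⊤] (X k))
    (hC : ∀ k ω, |X k ω| ≤ C) (hkl : InformationTheory.klDiv μ ν ≠ ⊤) :
    ∑ k ∈ Finset.range K,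
        ∫ ω, |μ[X k | MeasurableSpace.comap (fun ω => fun j : Fin (k + 1) => Y j ω) ⊤] ω
          - ν[X k | MeasurableSpace.comap (fun ω => fun j : Fin (k + 1) => Y j ω) ⊤] ω| ∂μ
      ≤ C * Real.sqrt (2 * K * (InformationTheory.klDiv μ ν).toReal) := by
  obtain ⟨hμν, h_int⟩ := klDiv_ne_top_iff.1 hkl
  have hsnoc : ∀ (k : ℕ) (ω : Ω), Fin.snoc (fun j : Fin (k + 1) => Y j ω) (Y (k + 1) ω) =
      fun j : Fin (k + 1 + 1) => Y j ω := by
    intro k ω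
    funext j
    refine Fin.lastCases ?_ (fun i => ?_) j
    · simp
    · simp
  exact sum_integral_abs_condExp_sub_condExp_le μ ν hμν h_int (T := fun k => Fin (k + 1) → S)
    (fun k ω j => Y j ω) Y (fun k => (Equiv.prodComm _ _).trans (Fin.snocEquiv fun _ => S))
    (fun k ω => hsnoc k ω) hle X hX hC K

end Summit.AtomisticToContinuum.HydrodynamicLimit.Theorems.EquilibriumForecastLine

end
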